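import Mathlib.RingTheory.DedekindDomain.AdicValuation
import Mathlib.RingTheory.PrincipalIdealDomain
import HarnessLib

/-!
# In a principal ideal domain, even valuations everywhere means unit times square

Let `R` be a Dedekind domain which is a principal ideal ring, with fraction field `K`. If
`z ∈ Kˣ` has even valuation at every height-one prime `v` of `R`
(`2 ∣ log (v.valuation K z)`), then `z = u · w²` for a unit `u ∈ Rˣ` and some `w ∈ K`
(`exists_unit_mul_sq_of_forall_two_dvd_log_valuation`). This is the case `n = 2` of the exact
sequence `1 → Rˣ/Rˣⁿ → K(∅, n) → Cl(R)[n] → 1` for the Selmer group `K(∅, n)` with trivial class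
group (Mathlib has the injection `IsDedekindDomain.selmerGroup.fromUnitLift_injective` but not the
surjectivity for principal `R`); it is the input "`h_K = 1`" of the complete `2`-descents over
`ℚ(√41)`, `ℚ(√73)`, `ℚ(√-1)` (T. Dokchitser–V. Dokchitser, *A note on the Mordell–Weil rank modulo
n*, J. Number Theory 131 (2011), proof of Thm. 2), replacing unique factorisation in `ℤ` of the
tree's descents over `ℚ`.

Proof: for `r ∈ R`, by well-founded induction on divisibility: a non-unit `r ≠ 0` has a prime
factor `p`; the valuation at `(p)` being even and positive, `p² ∣ r`, and `r/p²` again has even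
valuations (`exists_unit_mul_sq_of_forall_two_dvd_log_intValuation`); for `z = a/b ∈ K` apply
this to `ab = z b²`.

Theorems and one auxiliary definition (the height-one prime of a prime element); no named facts.

## References

* J. H. Silverman, *The Arithmetic of Elliptic Curves*, 2nd ed., GTM 106 (2009), Prop. VIII.1.6
  and X.1 (the group `K(S, 2)`; units and ideal classes modulo squares). [folklore]
-/

open IsDedekindDomain IsDedekindDomain.HeightOneSpectrum WithZero

namespace Literature.NumberTheory.NumberFields

variable {R : Type*} [CommRing R] [IsDedekindDomain R]

/-- The height-one prime generated by a prime element. [folklore] -/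
noncomputable def primeSpectrumOfPrime {p : R} (hp : Prime p) : HeightOneSpectrum R :=
  ⟨Ideal.span {p}, (Ideal.span_singleton_prime hp.ne_zero).mpr hp,
    by rw [Ne, Ideal.span_singleton_eq_bot]; exact hp.ne_zero⟩

omit [IsDedekindDomain R] in
/-- The ideal of `primeSpectrumOfPrime`. [folklore] -/
@[simp] theorem primeSpectrumOfPrime_asIdeal {p : R} (hp : Prime p) :
    (primeSpectrumOfPrime hp).asIdeal = Ideal.span {p} := rfl

/-- At the prime `(p)`, an element with even valuation which is divisible by `p` is divisible by
`p²`. [folklore] -/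
theorem sq_dvd_of_dvd_of_two_dvd_log {p r : R} (hp : Prime p) (hr : r ≠ 0) (hpr : p ∣ r)
    (h2 : (2 : ℤ) ∣ log ((primeSpectrumOfPrime hp).intValuation r)) : p ^ 2 ∣ r := by
  set v := primeSpectrumOfPrime hp with hv
  have hne : v.intValuation r ≠ 0 := v.intValuation_ne_zero r hr
  -- `v(r) ≤ exp(-1)` since `p ∣ r`
  have h1 : v.intValuation r ≤ exp (-((1 : ℕ) : ℤ)) := by
    rw [intValuation_le_pow_iff_mem, pow_one]
    exact Ideal.mem_span_singleton.mpr hpr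
  have hlog1 : log (v.intValuation r) ≤ -1 := by
    rw [log_le_iff_le_exp hne]; exact_mod_cast h1
  -- evenness forces `≤ -2`
  have hlog2 : log (v.intValuation r) ≤ -((2 : ℕ) : ℤ) := by
    obtain ⟨k, hk⟩ := h2
    rw [hk] at hlog1 ⊢
    push_cast
    omega
  have h2' : v.intValuation r ≤ exp (-((2 : ℕ) : ℤ)) := by
    rw [← log_le_iff_le_exp hne]; exact hlog2
  rw [intValuation_le_pow_iff_mem, primeSpectrumOfPrime_asIdeal, Ideal.span_singleton_pow] at h2'
  exact Ideal.mem_span_singleton.mp h2'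

/-- Valuations of `p² r'` versus `r'`: at every height-one prime they differ by an even amount.
[folklore] -/
theorem two_dvd_log_intValuation_of_sq_mul {p r' : R} (hp : p ≠ 0) (hr' : r' ≠ 0)
    (v : HeightOneSpectrum R) (h : (2 : ℤ) ∣ log (v.intValuation (p ^ 2 * r'))) :
    (2 : ℤ) ∣ log (v.intValuation r') := by
  have hp1 : v.intValuation p ≠ 0 := v.intValuation_ne_zero _ hp
  have hp2 : v.intValuation (p ^ 2) ≠ 0 := v.intValuation_ne_zero _ (pow_ne_zero 2 hp)
  have hr'0 : v.intValuation r' ≠ 0 := v.intValuation_ne_zero _ hr'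
  rw [map_mul, log_mul hp2 hr'0, map_pow, log_pow] at h
  obtain ⟨k, hk⟩ := h
  refine ⟨k - log (v.intValuation p), ?_⟩
  have : (2 : ℕ) • log (v.intValuation p) = 2 * log (v.intValuation p) := by
    simp [two_mul]
  linear_combination hk - this

section PID

variable [IsPrincipalIdealRing R]

/-- **Even valuations in a PID, integral version**: a non-zero `r ∈ R` whose valuation at every
height-one prime is even is a unit times a square. [folklore] -/
theorem exists_unit_mul_sq_of_forall_two_dvd_log_intValuation {r : R} (hr : r ≠ 0)
    (h : ∀ v : HeightOneSpectrum R, (2 : ℤ) ∣ log (v.intValuation r)) :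
    ∃ (u : Rˣ) (g : R), r = u * g ^ 2 := by
  revert hr h
  refine WellFounded.induction (C := fun r : R => r ≠ 0 →
      (∀ v : HeightOneSpectrum R, (2 : ℤ) ∣ log (v.intValuation r)) → ∃ (u : Rˣ) (g : R), r = u * g ^ 2)
    wellFounded_dvdNotUnit r (fun r ih => ?_)
  intro hr h
  by_cases hu : IsUnit r
  · exact ⟨hu.unit, 1, by simp⟩
  · obtain ⟨p, hpirr, hpr⟩ := WfDvdMonoid.exists_irreducible_factor hu hr
    have hp : Prime p := UniqueFactorizationMonoid.irreducible_iff_prime.mp hpirr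
    obtain ⟨r', hr'⟩ := sq_dvd_of_dvd_of_two_dvd_log hp hr hpr (h _)
    have hr'0 : r' ≠ 0 := by
      rintro rfl; rw [mul_zero] at hr'; exact hr hr'
    have hnu : ¬ IsUnit (p ^ 2) := fun h2 => hp.not_unit (isUnit_of_dvd_unit (dvd_pow_self p two_ne_zero) h2)
    have hlt : DvdNotUnit r' r := ⟨hr'0, p ^ 2, hnu, by rw [hr', mul_comm]⟩
    have h' : ∀ v : HeightOneSpectrum R, (2 : ℤ) ∣ log (v.intValuation r') := fun v =>
      two_dvd_log_intValuation_of_sq_mul hp.ne_zero hr'0 v (hr' ▸ h v)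
    obtain ⟨u, g, hg⟩ := ih r' hlt hr'0 h'
    exact ⟨u, p * g, by rw [hr', hg]; ring⟩

/-- **Even valuations in a PID**: for `R` a principal Dedekind domain with fraction field `K`,
an element `z ∈ Kˣ` with `2 ∣ ord_v(z)` at every height-one prime `v` is `u · w²` with
`u ∈ Rˣ`, `w ∈ K` (trivial class group: `K(∅, 2) = Rˣ/Rˣ²`). [folklore] -/
theorem exists_unit_mul_sq_of_forall_two_dvd_log_valuation {K : Type*} [Field K] [Algebra R K]
    [IsFractionRing R K] {z : K} (hz : z ≠ 0)
    (h : ∀ v : HeightOneSpectrum R, (2 : ℤ) ∣ log (v.valuation K z)) :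
    ∃ (u : Rˣ) (w : K), z = algebraMap R K u * w ^ 2 := by
  obtain ⟨a, b, hb, rfl⟩ := IsFractionRing.div_surjective (A := R) z
  have hb0 : b ≠ 0 := nonZeroDivisors.ne_zero hb
  have hinj : Function.Injective (algebraMap R K) := IsFractionRing.injective R K
  have hbK : algebraMap R K b ≠ 0 := (map_ne_zero_iff _ hinj).mpr hb0
  have ha0 : a ≠ 0 := by
    rintro rfl; rw [map_zero, zero_div] at hz; exact hz rfl
  -- `ab = z b²` has even valuations
  have hc : ∀ v : HeightOneSpectrum R, (2 : ℤ) ∣ log (v.intValuation (a * b)) := by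
    intro v
    have hva : v.intValuation a ≠ 0 := v.intValuation_ne_zero a ha0
    have hvb : v.intValuation b ≠ 0 := v.intValuation_ne_zero b hb0
    have h1 := h v
    rw [Valuation.map_div, valuation_of_algebraMap, valuation_of_algebraMap, log_div hva hvb] at h1
    rw [map_mul, log_mul hva hvb]
    obtain ⟨k, hk⟩ := h1
    exact ⟨k + log (v.intValuation b), by omega⟩
  obtain ⟨u, g, hg⟩ :=
    exists_unit_mul_sq_of_forall_two_dvd_log_intValuation (mul_ne_zero ha0 hb0) hc
  refine ⟨u, algebraMap R K g / algebraMap R K b, ?_⟩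
  have e : algebraMap R K a / algebraMap R K b =
      algebraMap R K (a * b) / (algebraMap R K b) ^ 2 := by
    rw [map_mul]; field_simp
  rw [e, hg, map_mul, map_pow]
  field_simp

end PID

end Literature.NumberTheory.NumberFields
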